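import Summits.FinalStateConjecture.FinalStateConjecture.Theorems.EIHFluxBalanceInertialRecessionAnsatzDecay
import Summits.FinalStateConjecture.FinalStateConjecture.Theorems.EIHFluxBalanceInertialRecessionBoostCalculus
import Summits.FinalStateConjecture.FinalStateConjecture.Theorems.EIHFluxBalanceInertialRecessionLorentz

/-!
# Route EIHFluxBalance — `InertialRecession`: the other holes' fields near a receding hole

Helper file for the crux `stmt-FinalStateConjecture-10166`
(`Summit.FinalStateConjecture.FinalStateConjecture.Theses.EIHFluxBalance.InertialRecession`).

The near-zone estimate of the hole chart of hole `i` (`…HoleTransport`) consumes, at the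
transported lab point `z = A(x')` (lab time `w`, within lab distance `R` of the painted centre
`ξᵢ(w)`), the `C²` smallness `≤ η₂` of every OTHER painted summand
`Hⱼ = boostedKerrBilin (boost vⱼ(z⁰)) (z⁰, ξⱼ(z⁰)) Mⱼ 0 − η` together with the positivity of its
painted radius there. Both follow, eventually in `w`, from the separation `‖ξᵢ − ξⱼ‖ → ∞`, the
eventual boundedness of two derivatives of the painted velocities and centres, and the `Cᵐ`
far-field decay of modulated Kerr–Schild summands (`…AnsatzDecay`):
`eventually_otherHoles_small`.
-/

noncomputable section

open scoped Topology ContDiff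
open Filter Set Metric Function TopologicalSpace Literature.Geometry.Lorentzian

namespace Summit.FinalStateConjecture.FinalStateConjecture.Theorems

-- operator-norm instance paths on form-valued multilinear maps are slow to unify
set_option synthInstance.maxHeartbeats 200000 in
/-- **The other holes are `C²`-small near hole `i`, eventually.** For every lab radius `R` and
`η₂ > 0`, eventually in the lab time `w`: at every lab point `z` of the slab `{z⁰ = w}` within lab
distance `R` of `ξᵢ(w)`, every other painted summand `Hⱼ` (`j ≠ i`) has positive painted radius and
`‖Dˡ Hⱼ(z)‖ ≤ η₂` for `l ≤ 2`. [folklore] -/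
theorem eventually_otherHoles_small' {N : ℕ} (i : Fin N) (M : Fin N → ℝ) (ξ v : Fin N → ℝ → E3)
    {κ₀ : ℝ} (hκ₀ : κ₀ < 1) (hvs : ∀ j t, ‖v j t‖ ≤ κ₀) (hv1 : ∀ j t, ‖v j t‖ < 1)
    (hv : ∀ j, ContDiff ℝ ∞ (v j)) (hξ : ∀ j, ContDiff ℝ ∞ (ξ j)) {Γ T₀ : ℝ}
    (hvb : ∀ j t, T₀ ≤ t → ∀ l, 1 ≤ l → l ≤ 2 → ‖iteratedDeriv l (v j) t‖ ≤ Γ)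
    (hξb : ∀ j t, T₀ ≤ t → ∀ l, 1 ≤ l → l ≤ 2 → ‖iteratedDeriv l (ξ j) t‖ ≤ Γ)
    (hsep : ∀ j ≠ i, Tendsto (fun t ↦ ‖ξ i t - ξ j t‖) atTop atTop)
    {H : Fin N → E4 → E4 →L[ℝ] E4 →L[ℝ] ℝ}
    (hH : ∀ j z, H j z = boostedKerrBilin (Lorentz.boost (v j (z 0)) (hv1 j (z 0)))
      (E4.ofTimeSpace (z 0) (ξ j (z 0))) (M j) 0 z - Minkowski.bilin)
    (R : ℝ) {η₂ : ℝ} (hη₂ : 0 < η₂) :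
    ∀ᶠ w in atTop, ∀ j ≠ i, ∀ z : E4, z 0 = w → ‖E4.spatial z - ξ i w‖ ≤ R →
      0 < E4.spatialNorm (Lorentz.boostCLM (-v j w) (z - E4.ofTimeSpace w (ξ j w))) ∧
      ∀ l ≤ 2, ‖iteratedFDeriv ℝ l (H j) z‖ ≤ η₂ := by
  -- the normalised frames
  set Λ' : Fin N → ℝ → lorentzGroup := fun j t ↦ Lorentz.boost (v j t) (hv1 j t) with hΛ'
  have hsymm : ∀ j, (fun s ↦ (((Λ' j s : E4 ≃L[ℝ] E4).symm : E4 →L[ℝ] E4))) =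
      fun s ↦ Lorentz.boostCLM (-v j s) := fun j ↦ funext fun s ↦ coe_boost_symm' (hv1 j s)
  have hΛ'c : ∀ j, ContDiff ℝ ∞ (fun s ↦ (((Λ' j s : E4 ≃L[ℝ] E4).symm : E4 →L[ℝ] E4))) :=
    fun j ↦ by
      rw [hsymm j]
      exact contDiff_boostCLM_neg_comp (hv j) (hv1 j)
  have hHj : ∀ j, H j = fun y ↦ boostedKerrBilin (Λ' j (y 0)) (E4.ofTimeSpace (y 0) (ξ j (y 0)))
      (M j) 0 y - Minkowski.bilin := fun j ↦ funext (hH j)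
  -- uniform derivative bounds for the inverse frames, orders `≤ 2`
  obtain ⟨Γ', hΓ'⟩ := exists_bound_iteratedDeriv_boostCLM_neg_comp 2 hκ₀ Γ
  set Γ₁ : ℝ := max (max Γ' Γ) 1 with hΓ₁
  have hΓ₁1 : 1 ≤ Γ₁ := le_max_right _ _
  have hΛ'b : ∀ j t, T₀ ≤ t → ∀ l ≤ 2,
      ‖iteratedDeriv l (fun s ↦ (((Λ' j s : E4 ≃L[ℝ] E4).symm : E4 →L[ℝ] E4))) t‖ ≤ Γ₁ := by
    intro j t ht l hl
    rw [hsymm j]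
    exact (hΓ' (v j) t ((hv j).of_le (WithTop.coe_le_coe.mpr le_top)) (hvs j)
      (fun l' hl1 hl' ↦ hvb j t ht l' hl1 hl') l hl).trans
      ((le_max_left _ _).trans (le_max_left _ _))
  have hξb' : ∀ j t, T₀ ≤ t → ∀ l, 1 ≤ l → l ≤ 2 → ‖iteratedDeriv l (ξ j) t‖ ≤ Γ₁ :=
    fun j t ht l hl1 hl ↦ (hξb j t ht l hl1 hl).trans ((le_max_right _ _).trans (le_max_left _ _))
  -- decay constants for the orders `≤ 2`
  have hdec := fun m : ℕ ↦ exists_norm_iteratedFDeriv_ansatzSummand_le' m hΓ₁1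
  choose C hC0 hC using hdec
  set Cmax : ℝ := C 0 + C 1 + C 2 with hCmax
  have hCmax0 : 0 ≤ Cmax := by have := hC0 0; have := hC0 1; have := hC0 2; positivity
  have hCm : ∀ m ≤ 2, C m ≤ Cmax := by
    intro m hm
    have := hC0 0; have := hC0 1; have := hC0 2
    interval_cases m <;> simp only [hCmax] <;> linarith
  set Mmax : ℝ := ∑ j, |M j| with hMmax
  have hMj : ∀ j, |M j| ≤ Mmax := fun j ↦
    Finset.single_le_sum (f := fun j ↦ |M j|) (fun _ _ ↦ abs_nonneg _) (Finset.mem_univ j)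
  have hMmax0 : 0 ≤ Mmax := Finset.sum_nonneg fun _ _ ↦ abs_nonneg _
  -- the required separation
  set D₀ : ℝ := R + 1 + (Mmax * Cmax / η₂ + 1) with hD₀
  have e1 : ∀ᶠ w in atTop, T₀ ≤ w := eventually_ge_atTop T₀
  have e2 : ∀ᶠ w in atTop, ∀ j, j ≠ i → D₀ ≤ ‖ξ i w - ξ j w‖ := by
    refine eventually_all.mpr fun j ↦ ?_
    by_cases hj : j = i
    · exact Eventually.of_forall fun w h ↦ absurd hj h
    · exact ((hsep j hj).eventually (eventually_ge_atTop D₀)).mono fun w hw _ ↦ hw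
  filter_upwards [e1, e2] with w hw1 hw2
  intro j hj z hz0 hzR
  have hsepj := hw2 j hj
  -- lab distance from hole `j`
  have hdist : R + 1 + (Mmax * Cmax / η₂ + 1) - R ≤ ‖E4.spatial z - ξ j w‖ := by
    have h1 : ‖ξ i w - ξ j w‖ ≤ ‖E4.spatial z - ξ j w‖ + ‖E4.spatial z - ξ i w‖ := by
      have := norm_sub_le (E4.spatial z - ξ j w) (E4.spatial z - ξ i w)
      have e : E4.spatial z - ξ j w - (E4.spatial z - ξ i w) = ξ i w - ξ j w := by abel
      rwa [e] at this
    linarith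
  have hd1 : 1 ≤ ‖E4.spatial z - ξ j w‖ := by
    have : 0 ≤ Mmax * Cmax / η₂ := by positivity
    linarith
  have hdq : Mmax * Cmax / η₂ + 1 ≤ ‖E4.spatial z - ξ j w‖ := by linarith
  -- positivity of the painted radius
  obtain ⟨h0, hn⟩ := sub_ofTimeSpace_apply_zero hz0 (ξ j w)
  have hpos : 0 < E4.spatialNorm (Lorentz.boostCLM (-v j w) (z - E4.ofTimeSpace w (ξ j w))) := by
    have h1 := norm_le_spatialNorm_lorentz_apply (Λ' j w)⁻¹ h0
    rw [coe_lorentz_inv] at h1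
    have h2 : (Λ' j w : E4 ≃L[ℝ] E4).symm (z - E4.ofTimeSpace w (ξ j w)) =
        Lorentz.boostCLM (-v j w) (z - E4.ofTimeSpace w (ξ j w)) :=
      DFunLike.congr_fun (coe_boost_symm' (hv1 j w)) _
    rw [h2, hn] at h1
    linarith
  refine ⟨hpos, fun l hl ↦ ?_⟩
  -- the decay estimate
  have hΛl : ContDiff ℝ l (fun s ↦ (((Λ' j s : E4 ≃L[ℝ] E4).symm : E4 →L[ℝ] E4))) :=
    (hΛ'c j).of_le (by exact_mod_cast le_top)
  have hξl : ContDiff ℝ l (ξ j) := (hξ j).of_le (by exact_mod_cast le_top)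
  have h := hC l (M j) 0 (Λ' j) (ξ j) w z hΛl hξl (fun k hk ↦ hΛ'b j w hw1 k (hk.trans hl))
    (fun k hk1 hk ↦ hξb' j w hw1 k hk1 (hk.trans hl)) hz0
    (by rw [abs_zero, mul_zero, max_eq_left zero_le_one]; exact hd1)
  rw [hHj j]
  refine h.trans ?_
  have hnum : |M j| * C l ≤ Mmax * Cmax := mul_le_mul (hMj j) (hCm l hl) (hC0 l) hMmax0
  have hdpos : 0 < ‖E4.spatial z - ξ j w‖ := one_pos.trans_le hd1
  rw [div_le_iff₀ hdpos]
  calc |M j| * C l ≤ Mmax * Cmax := hnum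
    _ = η₂ * (Mmax * Cmax / η₂) := by field_simp
    _ ≤ η₂ * (Mmax * Cmax / η₂ + 1) := by nlinarith
    _ ≤ η₂ * ‖E4.spatial z - ξ j w‖ := mul_le_mul_of_nonneg_left hdq hη₂.le

-- operator-norm instance paths on form-valued multilinear maps are slow to unify
set_option synthInstance.maxHeartbeats 200000 in
/-- Registered sub-goal form (stub `eventually_otherHoles_small` of the crux item) of
`eventually_otherHoles_small'`. [folklore] -/
theorem eventually_otherHoles_small : open Literature.Geometry.Lorentzian Filter Topology in ∀ {N : ℕ} (i : Fin N) (M : Fin N → ℝ) (ξ v : Fin N → ℝ → E3) {κ₀ : ℝ}, κ₀ < 1 → (∀ j t, ‖v j t‖ ≤ κ₀) → ∀ (hv1 : ∀ j t, ‖v j t‖ < 1), (∀ j, ContDiff ℝ ((⊤ : ℕ∞) : WithTop ℕ∞) (v j)) → (∀ j, ContDiff ℝ ((⊤ : ℕ∞) : WithTop ℕ∞) (ξ j)) → ∀ {Γ T₀ : ℝ}, (∀ j t, T₀ ≤ t → ∀ l, 1 ≤ l → l ≤ 2 → ‖iteratedDeriv l (v j) t‖ ≤ Γ) → (∀ j t,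 T₀ ≤ t → ∀ l, 1 ≤ l → l ≤ 2 → ‖iteratedDeriv l (ξ j) t‖ ≤ Γ) → (∀ j ≠ i, Tendsto (fun t ↦ ‖ξ i t - ξ j t‖) atTop atTop) → ∀ {H : Fin N → E4 → E4 →L[ℝ] E4 →L[ℝ] ℝ}, (∀ j z, H j z = boostedKerrBilin (Lorentz.boost (v j (z 0)) (hv1 j (z 0))) (E4.ofTimeSpace (z 0) (ξ j (z 0))) (M j) 0 z - Minkowski.bilin) → ∀ (R : ℝ) {η₂ : ℝ}, 0 < η₂ → ∀ᶠ w in atTop, ∀ j ≠ i, ∀ z : E4, z 0 = w → ‖E4.spatial z - ξ i w‖ ≤ R → 0 < E4.spatialNorm (Lorentz.boostCLM (-v j w) (z - E4.ofTimeSpace w (ξ j w))) ∧ ∀ l ≤ 2, ‖iteratedFDeriv ℝ l (H j) z‖ ≤ η₂ :=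
  fun i M ξ v _ hκ₀ hvs hv1 hv hξ _ _ hvb hξb hsep _ hH R _ hη₂ ↦
    eventually_otherHoles_small' i M ξ v hκ₀ hvs hv1 hv hξ hvb hξb hsep hH R hη₂

end Summit.FinalStateConjecture.FinalStateConjecture.Theorems

end
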